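import Summits.Ventures.DiscreteObjects.UnitDistance.QuadraticPlanesFourB
import Summits.Ventures.DiscreteObjects.UnitDistance.PlaneSqrt59Four
import Summits.Ventures.DiscreteObjects.UnitDistance.PlaneSqrt131Four
import Summits.Ventures.DiscreteObjects.UnitDistance.PlaneSqrt311Bounds
import HarnessLib

/-!
# Quadratic planes with chromatic number four, III: `d = 59, 131`, the table of `d ≡ 3 (mod 4)` up to `71`, and `χ(ℚ(√311)²) ≥ 4`
(cell `pub-namedobj`, target (U), seats udg g13 / g14 — summary)

Framing (verbatim for the cell): lottery ticket; floor = certified bounds/negative ranges.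

After `QuadraticPlanesFour.lean` (`d = 11, 23, 71`) and `QuadraticPlanesFourB.lean` (`d = 35, 119, 191`; `χ(ℚ(√47)²) ∈ {4, 5}`), two
more quadratic rows are exact: `χ(ℚ(√59)²) = χ(ℚ(√131)²) = 4` (`PlaneSqrt59Four.lean`, `PlaneSqrt131Four.lean`: explicit
triangle-free unit-distance graphs `W₅₉` on `909` and `W₁₃₁` on `1044` vertices with coordinates in `ℚ(√d)`, not 3-colourable by
kernel-checked RUP certificates of `626` and `145` steps; found by udg g13 by mixing two genuinely mixed norm classes of unit vectors —
denominators `30, 34` for `59`, `30, 130` for `131`), and `4 ≤ χ(ℚ(√311)²) ≤ 5` (`PlaneSqrt311Bounds.lean`, `W₃₁₁` on `145` vertices;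
no 4-colouring of `ℚ(√311)²` is known).  CONSEQUENCE (`quadratic_table_three_mod_four_le_71`): for every square-free
`d ≡ 3 (mod 4)` with `d ≤ 71` the value is now decided up to the single alternative at `47` —
`χ(ℚ(√d)²) = 3` for the ten `d ≢ 2 (mod 3)` (`3, 7, 15, 19, 31, 39, 43, 51, 55, 67`: odd cycle + 3-adic criterion),
`χ(ℚ(√d)²) = 4` for `d = 11, 23, 35, 59, 71`, and `χ(ℚ(√47)²) ∈ {4, 5}`; together with `χ = 2` for `d ≢ 3 (mod 4)`
(`chromaticNumber_plane_sqrt_eq_two_iff`) this is the whole quadratic table up to `71`.  Values `≥ 4` not found in print (PROVISIONAL;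
Fischer 1990 / Johnson 1987 give the upper bounds `≤ 4` for `d ≡ 3 (mod 8)`).
-/

noncomputable section

namespace Summit.Ventures.DiscreteObjects.UnitDistance

open SimpleGraph IntermediateField
open scoped IntermediateField

/-- TWO MORE EXACT QUADRATIC ROWS: `χ(ℚ(√59)²) = χ(ℚ(√131)²) = 4`. -/
theorem chromaticNumber_plane_sqrt_59_131 :
    (planeUnitDistanceGraph.induce (fieldPoints ℚ⟮Real.sqrt 59⟯)).chromaticNumber = 4 ∧
    (planeUnitDistanceGraph.induce (fieldPoints ℚ⟮Real.sqrt 131⟯)).chromaticNumber = 4 :=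
  ⟨chromaticNumber_plane_sqrt59, chromaticNumber_plane_sqrt131⟩

/-- The eight exact rows with value four known in the tree (udg g12: `11, 23, 71`; g13: `35, 119, 191`; g13/g14: `59, 131`),
atlas vocabulary. -/
theorem chromaticNumber_plane_multiSqrtField_eq_four_eight :
    ∀ d ∈ ({11, 23, 35, 59, 71, 119, 131, 191} : Finset ℕ),
      (planeUnitDistanceGraph.induce (fieldPoints (multiSqrtField {d}))).chromaticNumber = 4 := by
  intro d hd
  simp only [Finset.mem_insert, Finset.mem_singleton] at hd
  rcases hd with rfl | rfl | rfl | rfl | rfl | rfl | rfl | rfl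
  · exact chromaticNumber_plane_multiSqrtField_11
  · exact chromaticNumber_plane_multiSqrtField_23
  · exact chromaticNumber_plane_multiSqrtField_35
  · exact chromaticNumber_plane_multiSqrtField_59
  · exact chromaticNumber_plane_multiSqrtField_71
  · exact chromaticNumber_plane_multiSqrtField_119
  · exact chromaticNumber_plane_multiSqrtField_131
  · exact chromaticNumber_plane_multiSqrtField_191

/-- THE QUADRATIC TABLE FOR SQUARE-FREE `d ≡ 3 (mod 4)`, `d ≤ 71` (the sixteen values `3, 7, 11, 15, 19, 23, 31, 35, 39, 43, 47, 51,
55, 59, 67, 71`): `χ(ℚ(√d)²) = 3` for the ten `d ≢ 2 (mod 3)`, `= 4` for `d = 11, 23, 35, 59, 71`, and `4 ≤ χ(ℚ(√47)²) ≤ 5`. -/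
theorem quadratic_table_three_mod_four_le_71 :
    (∀ d ∈ ({3, 7, 15, 19, 31, 39, 43, 51, 55, 67} : Finset ℕ),
        (planeUnitDistanceGraph.induce (fieldPoints (multiSqrtField {d}))).chromaticNumber = 3) ∧
    (∀ d ∈ ({11, 23, 35, 59, 71} : Finset ℕ),
        (planeUnitDistanceGraph.induce (fieldPoints (multiSqrtField {d}))).chromaticNumber = 4) ∧
    (4 ≤ (planeUnitDistanceGraph.induce (fieldPoints (multiSqrtField {47}))).chromaticNumber ∧
      (planeUnitDistanceGraph.induce (fieldPoints (multiSqrtField {47}))).chromaticNumber ≤ 5) := by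
  refine ⟨?_, ?_, chromaticNumber_plane_multiSqrtField_47_bounds⟩
  · intro d hd
    simp only [Finset.mem_insert, Finset.mem_singleton] at hd
    rcases hd with rfl | rfl | rfl | rfl | rfl | rfl | rfl | rfl | rfl | rfl <;>
      exact chromaticNumber_plane_eq_three_of_mem_mod_four _ (by decide) (Finset.mem_singleton_self _) (by norm_num)
  · intro d hd
    simp only [Finset.mem_insert, Finset.mem_singleton] at hd
    rcases hd with rfl | rfl | rfl | rfl | rfl
    · exact chromaticNumber_plane_multiSqrtField_11
    · exact chromaticNumber_plane_multiSqrtField_23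
    · exact chromaticNumber_plane_multiSqrtField_35
    · exact chromaticNumber_plane_multiSqrtField_59
    · exact chromaticNumber_plane_multiSqrtField_71

/- `d = 311`: `4 ≤ χ(ℚ(√311)²) ≤ 5` is `chromaticNumber_plane_sqrt311_bounds` (`PlaneSqrt311Bounds.lean`; with `47` the second quadratic
   row whose lower bound exceeds every colouring the tree knows). -/

/-- The three new witnesses are triangle-free and not 3-colourable (`χ(W) = 4` for `W₅₉, W₁₃₁, W₃₁₁` is in the respective files). -/
theorem witnessesC_triangleFree_not_three_colourable :
    (w59Graph.CliqueFree 3 ∧ ¬ w59Graph.Colorable 3) ∧ (w131Graph.CliqueFree 3 ∧ ¬ w131Graph.Colorable 3) ∧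
    (w311Graph.CliqueFree 3 ∧ ¬ w311Graph.Colorable 3) := by
  have h177 : Irrational (Real.sqrt ((177 : ℕ) : ℝ)) :=
    irrational_sqrt_natCast_iff.2 (not_isSquare_of_between (r := 13) (by norm_num) (by norm_num))
  have h393 : Irrational (Real.sqrt ((393 : ℕ) : ℝ)) :=
    irrational_sqrt_natCast_iff.2 (not_isSquare_of_between (r := 19) (by norm_num) (by norm_num))
  have h933 : Irrational (Real.sqrt ((933 : ℕ) : ℝ)) :=
    irrational_sqrt_natCast_iff.2 (not_isSquare_of_between (r := 30) (by norm_num) (by norm_num))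
  have h59 := sqrt3_not_mem_adjoin_sqrt 59 (by norm_num : Nat.Prime 59).irrational_sqrt
    (by convert h177 using 2; push_cast; norm_num)
  have h131 := sqrt3_not_mem_adjoin_sqrt 131 (by norm_num : Nat.Prime 131).irrational_sqrt
    (by convert h393 using 2; push_cast; norm_num)
  have h311 := sqrt3_not_mem_adjoin_sqrt 311 (by norm_num : Nat.Prime 311).irrational_sqrt
    (by convert h933 using 2; push_cast; norm_num)
  rw [Nat.cast_ofNat] at h59 h131 h311
  have tf : ∀ {n : ℕ} {W : SimpleGraph (Fin n)} (K : IntermediateField ℚ ℝ),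
      (planeUnitDistanceGraph.induce (fieldPoints K)).CliqueFree 3 →
      (W →g planeUnitDistanceGraph.induce (fieldPoints K)) → W.CliqueFree 3 := by
    intro n W K hK f s hs
    rw [is3Clique_iff] at hs
    obtain ⟨a, b, c, hab, hac, hbc, -⟩ := hs
    exact hK _ (is3Clique_triple_iff.2 ⟨f.map_rel hab, f.map_rel hac, f.map_rel hbc⟩)
  exact ⟨⟨tf _ (cliqueFree_three_plane_of_sqrt3_not_mem _ h59) w59Hom, not_colorable_three_w59Graph⟩,
    ⟨tf _ (cliqueFree_three_plane_of_sqrt3_not_mem _ h131) w131Hom, not_colorable_three_w131Graph⟩,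
    ⟨tf _ (cliqueFree_three_plane_of_sqrt3_not_mem _ h311) w311Hom, not_colorable_three_w311Graph⟩⟩

end Summit.Ventures.DiscreteObjects.UnitDistance
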